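import Summits.QuantumAdvantage.AdviceFreeQNC0.NPGamma37Sparse
import HarnessLib

/-!
# Cell qa-qnc0 — rung (NP-ΓΛ) `RingHardFourierSparse3` ⊇ (NP-Γ) ∪ (NP-Λ): outputs = ARBITRARY Boolean functions of `≤ log₂ n` polynomials from an insulated-sparse span (dense LINEAR forms always allowed).

Planner qa-qnc0-p2 gen 34 (INBOX P2-34g, memo HOME/qa-qnc0-p2/ROUND-34P2.md §4.8).  Imports the (NP-Γ) files
`NPGamma37{Slicing,Span,Family,Assembly,Sparse}` (generic pair slicing along a separated window system, the
slice-affinity / coefficient-invariance predicates `SA`/`IA`, the resonance MGF `resonance_poly`, `S1`, and the insulation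
lemma `H1'_H2'_of_insulated`).

THEOREM (NP-ΓΛ) `ringHardFourierSparse3_explicit`: for `n ≥ 200`, a support family `𝓢` admitting `8·log₂ n` insulated windows
(`NPGamma37.InsulatedWindows`), `R ≤ log₂ n`, ANY `Q : Fin n → Fin R → CubeFn (ZMod 3) n` with every `Q g i ∈ span {mono S : S ∈ 𝓢}`
and ANY truth tables `f : Fin n → (Fin R → ZMod 3) → Bool`, the strategy `x ↦ (f g (Q g 1 x, …, Q g R x))_g` wins the `p = 3`
ring-HLF relation on at most `(1 − n^{−7})·2^{n−1}` odd inputs.  (NP-Γ) is `R = 1`, `f = [· = 1]`; since singletons never break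
insulation, linear forms are always available, and the DENSE special case `𝓢 = {singletons}` is
THEOREM (NP-Λ) `ringHardLinForms3_explicit`: every output an arbitrary function of `≤ log₂ n` LINEAR FORMS over `𝔽₃` (dense
coefficient vectors) ⇒ at most `(1 − n^{−7})·2^{n−1}` odd wins (`RingHardLinForms3`, e = 7, n₀ = 200).

THE ONE NEW STEP: FOURIER INVERSION ON `𝔽₃^R` WITH VALUES IN `𝔽₄` (`fourier`: `ι(f t) = Σ_{k ∈ 𝔽₃^R} f̂(k) ω^{⟨k,t⟩}`, valid
because `Σ_{c ∈ 𝔽₃} ω^{cs} = [s = 0]` in characteristic 2).  On a pair slice each Fourier atom of output `g` is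
`f̂_g(k)·ω^{Q_{g,k}(x(a))}·χ_{rv(Q_{g,k})}(v)` with `Q_{g,k} = Σ_i k_i Q_{g,i}` (`QK`) again in the span, hence slice-affine (E1)
and coefficient-invariant (E2) (`SA_IA_of_mem_span`); the character family of a slice has `(n+1)·2·(3^R + 4F)` members
(`IxL`), every Fourier test row `rv(Q_{g,k}) + σ·path_g` obeys the resonance MGF `Σ_a 2^{Z} ≤ 2ⁿ(3/2)^F` (`resonance_poly`,
`m = 1`), and the (NP-Γ) assembly goes through verbatim provided `8·3^R·(n+1)·3^F ≤ 4^F`, `F = 8 log₂ n` — i.e. `R ≤ log₂ n`.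

SCOPE (honest): `1 − n^{−7}` laws for Fourier-dimension-`log n` outputs over insulated-sparse-plus-linear polynomials
(contains (NP₁), (NP-Γ), all `[q(x)+ℓ(x) = c]` with `q` a quadratic form of Boolean rank `≤ log₂ n − 2` such as
`e₂ = Σ_{a<b} x_a x_b = C(e₁,2)`, all `MOD₃∘AND_{≤ log n}∘MOD₃` outputs); NOT the uniform-`θ` crux `RingDenseResidualLt3`
(stmt-QuantumAdvantage-22907), whose residual is now located at outputs of HIGH Boolean rank / high `𝔽₃`-Fourier dimension
over every insulated-sparse algebra.
-/

noncomputable section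

namespace Summit.QuantumAdvantage.AdviceFreeQNC0.NPGamma37Proof

open Finset F4
open Classical
open Summit.QuantumAdvantage.AdviceFreeQNC0.AffBells37 (expo chiZ exists_ne_one_of_mass_lt ev L sparse sparse_ne_one
  two_pow_L_le ωz ωz_zero ωz_add ωz_natCast ωz_sq ωz_sum lin chiZ_eq_ωz lin_add lin_mul lin_single ιF_xor ιF_decide_eq_zero
  ιF_eq_omega ιF_ringWinU)
open Summit.QuantumAdvantage.AdviceFreeQNC0.Resonance37G (four_orbit_le orbit_mgf sg bt sg_not slope_eq no_three
  blockCpl blockCpl_blockCpl blockCpl_involutive blockCpl_apply_of_not_mem uExt_blockCpl xN xN_eq_xOfU xN_blockCpl_of_ne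
  xN_blockCpl_left xN_blockCpl_right Inv letter resonance_windows)
-- `wt` (weight of a cube-restricted character) is written `AffBells37.wt` throughout: the bare name would resolve to the
-- walk-word weight `Summit.QuantumAdvantage.AdviceFreeQNC0.wt` of `Elimination.lean`.

variable {F : ℕ}

section Fourier

open Literature.Computability.QuantumComplexity Literature.Computability.QuantumComplexity.RingHLF
open Literature.Computability.MetaComplexity
open AffBells23 AffBells26
open Summit.QuantumAdvantage.AdviceFreeQNC0.NPGamma37 (NCoupled InsulatedWindows)

variable {n : ℕ}
variable {N : ℕ}
variable {R : ℕ}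

/-! ### The statements -/

/-- **(NP-ΓΛ) `RingHardFourierSparse3`**: strategies whose every output is an arbitrary Boolean function of at most `log₂ n`
polynomials from the span of a support family admitting `C·log₂ n` insulated windows win the `p = 3` ring-HLF game on at
most a `1 − n^{−e}` fraction of the odd inputs. -/
def RingHardFourierSparse3 : Prop :=
  ∃ e C n₀ : ℕ, ∀ N ≥ n₀, ∀ 𝓢 : Set (Finset (Fin N)), InsulatedWindows 𝓢 (C * Nat.log 2 N) →
    ∀ R ≤ Nat.log 2 N, ∀ Q : Fin N → Fin R → Smolensky.CubeFn (ZMod 3) N,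
      (∀ g i, Q g i ∈ Submodule.span (ZMod 3) (Smolensky.mono (ZMod 3) '' 𝓢)) →
      ∀ f : Fin N → (Fin R → ZMod 3) → Bool,
        ((univ.filter fun x : Fin N → Bool =>
            OddZeros x ∧ RingHLF.Rel x (fun g => f g (fun i => Q g i x))).card : ℝ)
          ≤ (1 - 1 / (N : ℝ) ^ e) * (2 : ℝ) ^ (N - 1)

/-- the `𝔽₃`-linear form with coefficient vector `c`, as a function on the Boolean cube. -/
def LinF (c : Fin N → ZMod 3) : Smolensky.CubeFn (ZMod 3) N := fun x => ∑ m : Fin N, if x m then c m else 0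

/-- **(NP-Λ) `RingHardLinForms3`**: strategies whose every output is an arbitrary Boolean function of at most `log₂ n`
linear forms over `𝔽₃` (dense supports allowed) win the `p = 3` ring-HLF game on at most a `1 − n^{−e}` fraction of the
odd inputs. -/
def RingHardLinForms3 : Prop :=
  ∃ e n₀ : ℕ, ∀ N ≥ n₀, ∀ R ≤ Nat.log 2 N, ∀ Lf : Fin N → Fin R → Fin N → ZMod 3,
    ∀ f : Fin N → (Fin R → ZMod 3) → Bool,
      ((univ.filter fun x : Fin N → Bool =>
          OddZeros x ∧ RingHLF.Rel x (fun g => f g (fun i => ∑ m : Fin N, if x m then Lf g i m else 0))).card : ℝ)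
        ≤ (1 - 1 / (N : ℝ) ^ e) * (2 : ℝ) ^ (N - 1)

/-! ### Fourier inversion on `𝔽₃^R` with values in `𝔽₄` -/

/-- the pairing `⟨k, t⟩` on `𝔽₃^R`. -/
def dot (k t : Fin R → ZMod 3) : ZMod 3 := ∑ i, k i * t i

/-- `dot k` is additive (subtraction form). -/
theorem dot_sub (k t t' : Fin R → ZMod 3) : dot k (t - t') = dot k t - dot k t' := by
  unfold dot
  rw [← sum_sub_distrib]
  exact sum_congr rfl fun i _ => by rw [Pi.sub_apply, mul_sub]

/-- A sum over `ZMod 3` is the sum of the three values (`ZMod 3` is `Fin 3`; the finset form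
`univ = {0,1,2}` is `Literature.NumberTheory.QuadraticFields.ChowlaSelbergFifteen.univ_zmod_three`). -/
theorem sum_zmod3 {M : Type*} [AddCommMonoid M] (g : ZMod 3 → M) : ∑ c : ZMod 3, g c = g 0 + g 1 + g 2 :=
  Fin.sum_univ_three g

/-- orthogonality on one coordinate: `Σ_{c ∈ 𝔽₃} ω^{cs} = [s = 0]` (three ones make one in characteristic 2). -/
theorem sum_ωz_mul (s : ZMod 3) : ∑ c : ZMod 3, ωz (c * s) = ιF (decide (s = 0)) := by
  rw [sum_zmod3, ιF_decide_eq_zero, Fin.sum_univ_three]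
  simp only [Fin.val_zero, Fin.val_one, Fin.val_two, Nat.cast_zero, Nat.cast_one, Nat.cast_ofNat]

/-- `ιF (decide P)` is the indicator of `P` in `F4`. -/
theorem ιF_decide (P : Prop) [Decidable P] : ιF (decide P) = if P then 1 else 0 := by
  unfold ιF
  by_cases h : P <;> simp [h]

/-- orthogonality of the characters of `𝔽₃^R` in `𝔽₄`. -/
theorem sum_ωz_dot (s : Fin R → ZMod 3) : ∑ k : Fin R → ZMod 3, ωz (dot k s) = if s = 0 then 1 else 0 := by
  have h1 : ∀ k : Fin R → ZMod 3, ωz (dot k s) = ∏ i, ωz (k i * s i) := fun k => ωz_sum _ _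
  simp_rw [h1]
  have h2 : ∑ k : Fin R → ZMod 3, ∏ i, ωz (k i * s i) = ∏ i : Fin R, ∑ c : ZMod 3, ωz (c * s i) :=
    (Fintype.prod_sum fun i c => ωz (c * s i)).symm
  rw [h2]
  simp_rw [sum_ωz_mul, ιF_decide]
  rw [Fintype.prod_boole]
  by_cases hs : s = 0
  · subst hs
    simp
  · rw [if_neg hs, if_neg]
    intro h
    exact hs (funext h)

/-- the Fourier coefficients of a truth table `h : 𝔽₃^R → Bool`. -/
def fc (h : (Fin R → ZMod 3) → Bool) (k : Fin R → ZMod 3) : F4 := ∑ t, ιF (h t) * ωz (-dot k t)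

/-- **FOURIER INVERSION**: `ι(h t) = Σ_k ĥ(k) ω^{⟨k,t⟩}`. -/
theorem fourier (h : (Fin R → ZMod 3) → Bool) (t : Fin R → ZMod 3) :
    ιF (h t) = ∑ k : Fin R → ZMod 3, fc h k * ωz (dot k t) := by
  symm
  calc ∑ k : Fin R → ZMod 3, fc h k * ωz (dot k t)
      = ∑ k : Fin R → ZMod 3, ∑ t' : Fin R → ZMod 3, ιF (h t') * ωz (dot k (t - t')) := by
        refine Fintype.sum_congr _ _ fun k => ?_
        unfold fc
        rw [sum_mul]
        refine Fintype.sum_congr _ _ fun t' => ?_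
        rw [mul_assoc, ← ωz_add, dot_sub]
        congr 2
        ring
    _ = ∑ t' : Fin R → ZMod 3, ιF (h t') * ∑ k : Fin R → ZMod 3, ωz (dot k (t - t')) := by
        rw [sum_comm]
        exact Fintype.sum_congr _ _ fun t' => by rw [mul_sum]
    _ = ∑ t' : Fin R → ZMod 3, (if t = t' then ιF (h t') else 0) := by
        refine Fintype.sum_congr _ _ fun t' => ?_
        rw [sum_ωz_dot]
        by_cases htt : t = t'
        · subst htt; simp
        · rw [if_neg (sub_ne_zero.mpr htt), if_neg htt, mul_zero]
    _ = ιF (h t) := by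
        rw [Finset.sum_ite_eq]
        simp

/-! ### The strategy class and its Fourier supports -/

/-- the combined polynomial `Q_{g,k} = Σ_i k_i Q_{g,i}`: output `g` ↦ the `k`-th Fourier support. -/
def QK (Q : Fin (n + 1) → Fin R → Smolensky.CubeFn (ZMod 3) (n + 1)) (k : Fin R → ZMod 3) :
    Fin (n + 1) → Smolensky.CubeFn (ZMod 3) (n + 1) :=
  fun g => ∑ i, k i • Q g i

/-- the vector of polynomial values read by output `g`. -/
def qvals (Q : Fin N → Fin R → Smolensky.CubeFn (ZMod 3) N) (g : Fin N) (x : Fin N → Bool) : Fin R → ZMod 3 :=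
  fun i => Q g i x

/-- the strategy as a `ZMod 3`-valued family (`1` = output bit true), so that `zOf (PQ Q f) x g = f g (qvals Q g x)`. -/
def PQ (Q : Fin (n + 1) → Fin R → Smolensky.CubeFn (ZMod 3) (n + 1)) (f : Fin (n + 1) → (Fin R → ZMod 3) → Bool) :
    Fin (n + 1) → Smolensky.CubeFn (ZMod 3) (n + 1) :=
  fun g x => if f g (qvals Q g x) then 1 else 0

/-- The output word of the strategy `PQ Q f` is `g ↦ f g (qvals Q g x)`. -/
theorem zOf_PQ (Q : Fin (n + 1) → Fin R → Smolensky.CubeFn (ZMod 3) (n + 1)) (f : Fin (n + 1) → (Fin R → ZMod 3) → Bool)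
    (x : Fin (n + 1) → Bool) : zOf (PQ Q f) x = fun g => f g (qvals Q g x) := by
  funext g
  unfold zOf PQ
  cases f g (qvals Q g x) <;> simp

/-- The Fourier combination `QK Q k` evaluates the dot product with the value vector `qvals`. -/
theorem dot_qvals (Q : Fin (n + 1) → Fin R → Smolensky.CubeFn (ZMod 3) (n + 1)) (k : Fin R → ZMod 3) (g : Fin (n + 1))
    (x : Fin (n + 1) → Bool) : dot k (qvals Q g x) = QK Q k g x := by
  unfold dot qvals QK
  simp only [Finset.sum_apply, Pi.smul_apply, smul_eq_mul]

/-- The zero Fourier combination is the zero polynomial. -/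
theorem QK_zero_apply (Q : Fin (n + 1) → Fin R → Smolensky.CubeFn (ZMod 3) (n + 1)) (g : Fin (n + 1))
    (x : Fin (n + 1) → Bool) : QK Q (0 : Fin R → ZMod 3) g x = 0 := by
  unfold QK
  simp

/-- The test row of the zero combination vanishes. -/
theorem rv_QK_zero (Q : Fin (n + 1) → Fin R → Smolensky.CubeFn (ZMod 3) (n + 1)) (p : ℕ → ℕ) (a : Fin n → Bool)
    (g : Fin (n + 1)) : rv (QK Q (0 : Fin R → ZMod 3)) p a g = (0 : Fin F → ZMod 3) := by
  funext j
  unfold rv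
  rw [QK_zero_apply, QK_zero_apply, sub_zero]
  rfl

/-- The character of the zero row is `1`. -/
theorem chiZ_zero (v : Fin F → Bool) : chiZ (0 : Fin F → ZMod 3) v = 1 := by
  rw [chiZ_eq_ωz]
  unfold lin
  simp [ωz_zero]

/-- **(E1)/(E2) for the Fourier supports** of a strategy reading polynomials from an insulated span. -/
theorem SAIA_of_span {p q : ℕ → ℕ} (hS : Sep n F p) {𝓢 : Set (Finset (Fin (n + 1)))} (h1 : H1' p F 𝓢) (h2 : H2' p q F 𝓢)
    (Q : Fin (n + 1) → Fin R → Smolensky.CubeFn (ZMod 3) (n + 1))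
    (hQ : ∀ g i, Q g i ∈ Submodule.span (ZMod 3) (Smolensky.mono (ZMod 3) '' 𝓢)) (k : Fin R → ZMod 3) (g : Fin (n + 1)) :
    SA (n := n) p F (QK Q k g) ∧ IA p q F (QK Q k g) :=
  SA_IA_of_mem_span hS h1 h2 (Submodule.sum_mem _ fun i _ => Submodule.smul_mem _ _ (hQ g i))

/-- the singleton supports. -/
def Sing (N : ℕ) : Set (Finset (Fin N)) := Set.range fun m : Fin N => ({m} : Finset (Fin N))

/-- A singleton monomial is the coordinate indicator. -/
theorem mono_singleton (m : Fin N) (x : Fin N → Bool) :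
    Smolensky.mono (ZMod 3) ({m} : Finset (Fin N)) x = if x m then 1 else 0 := by
  unfold Smolensky.mono
  rw [prod_singleton]

/-- a linear form is in the span of the singleton monomials. -/
theorem LinF_mem_span (c : Fin N → ZMod 3) :
    LinF c ∈ Submodule.span (ZMod 3) (Smolensky.mono (ZMod 3) '' Sing N) := by
  have h : LinF c = ∑ m : Fin N, c m • Smolensky.mono (ZMod 3) ({m} : Finset (Fin N)) := by
    funext x
    unfold LinF
    rw [Finset.sum_apply]
    refine sum_congr rfl fun m _ => ?_
    rw [Pi.smul_apply, smul_eq_mul, mono_singleton]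
    by_cases hx : x m = true
    · simp [hx]
    · simp [hx]
  rw [h]
  exact Submodule.sum_mem _ fun m _ => Submodule.smul_mem _ _ (Submodule.subset_span ⟨{m}, ⟨m, rfl⟩, rfl⟩)

/-- Singleton supports satisfy `H1'` for every window system. -/
theorem H1'_sing {p : ℕ → ℕ} (hS : Sep n F p) : H1' p F (Sing (n + 1)) := by
  rintro S ⟨m, rfl⟩ j j' hjj ⟨i, hi, hiv⟩ ⟨i', hi', hi'v⟩
  rw [Finset.mem_singleton] at hi hi'
  subst hi; subst hi'
  rcases hS.ne hjj with h | h <;> omega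

/-- Singleton supports satisfy `H2'` for every window/insulator system. -/
theorem H2'_sing {p q : ℕ → ℕ} (hord : ∀ j < F, q j < p j ∧ p j + 1 < q (j + 1)) : H2' p q F (Sing (n + 1)) := by
  rintro S ⟨m, rfl⟩ i hi ⟨c, hc, hcq⟩ j ⟨i', hi', hi'v⟩
  rw [Finset.mem_singleton] at hc hi'
  subst hc; subst hi'
  have := q_ne_p hord i j.val hi j.isLt
  omega

/-! ### The slice expansion of the strategy bit -/

/-- the `k`-th Fourier atom of output `g` on the slice: `f̂_g(k) ω^{Q_{g,k}(x(a))} χ_{rv(Q_{g,k})}(v)`. -/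
def BkQ (Q : Fin (n + 1) → Fin R → Smolensky.CubeFn (ZMod 3) (n + 1)) (f : Fin (n + 1) → (Fin R → ZMod 3) → Bool)
    (p : ℕ → ℕ) (a : Fin n → Bool) (g : Fin (n + 1)) (k : Fin R → ZMod 3) (v : Fin F → Bool) : F4 :=
  fc (f g) k * ωz (QK Q k g (xOfU a)) * chiZ (rv (QK Q k) p a g) v

/-- **LEMMA BELL-Λ**: on the slice the output bit is a combination of `3^R` characters. -/
theorem ιF_zOf_UQ {p : ℕ → ℕ} (Q : Fin (n + 1) → Fin R → Smolensky.CubeFn (ZMod 3) (n + 1))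
    (f : Fin (n + 1) → (Fin R → ZMod 3) → Bool) (g : Fin (n + 1))
    (hSA : ∀ k : Fin R → ZMod 3, SA (n := n) p F (QK Q k g)) (a : Fin n → Bool) (v : Fin F → Bool) :
    ιF (zOf (PQ Q f) (xOfU (U p a v)) g) = ∑ k : Fin R → ZMod 3, BkQ Q f p a g k v := by
  rw [zOf_PQ]
  dsimp only
  rw [fourier (f g)]
  refine Fintype.sum_congr _ _ fun k => ?_
  unfold BkQ
  rw [dot_qvals, P_U (QK Q k) g (hSA k) a v, ωz_add, chiZ_eq_ωz, mul_assoc]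

/-- **LEMMA Y-Λ**: the strategy bit on the slice. -/
theorem ιF_yOf_UQ {p : ℕ → ℕ} (hS : Sep n F p) (Q : Fin (n + 1) → Fin R → Smolensky.CubeFn (ZMod 3) (n + 1))
    (f : Fin (n + 1) → (Fin R → ZMod 3) → Bool) (g : Fin (n + 1))
    (hSA : ∀ k : Fin R → ZMod 3, SA (n := n) p F (QK Q k g)) (a : Fin n → Bool) (v : Fin F → Bool) :
    ιF (yOf (PQ Q f) g (U p a v)) = (∑ k : Fin R → ZMod 3, BkQ Q f p a g k v) + (Gx p a v g + Gx p a v (nxt g)) := by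
  unfold yOf tGuess
  rw [ιF_xor, ιF_xor, ιF_zOf_UQ Q f g hSA, ιF_xOfU_U' hS, ιF_xOfU_U' hS]


end Fourier

end Summit.QuantumAdvantage.AdviceFreeQNC0.NPGamma37Proof
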